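import Summits.QuantumFields.YangMills.Theses.BalabanFluctuationExport
import HarnessLib

/-!
# Registered stub `stub_fluctuationExportGlue` of the line `response_regime_split` (crux `UVSeamRec`, stmt-QuantumFields-20043)

The route item `BalabanFluctuationExport.FluctuationExportGlue` (stmt-QuantumFields-26019, support):

  `CondResponse → CondDecoupling → BalabanFamilyExport.FamilyCeilings`,

i.e. the FINITE SUBSET EXPANSION that turns the one-point conditional response (a version `gᵢ` of
`E[pᵢ | Q_k]` within `C₁/b⁴` of the torus mean `mᵢ` for every block field) and the conditional decoupling
(`|∫ ∏_{i∈S} (pᵢ − gᵢ∘Q_k) · Ψ∘Q_k dμ| ≤ (C₂/b⁴)^{#S} ∫ |Ψ∘Q_k| dμ` for separated families and bounded test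
functions `Ψ` of the block field) into the plane-resolved E0′ ceilings `MomentBounds6OnSides` on the class
tori `M = 2·13ⁿ`:

* `∏ᵢ (pᵢ − mᵢ) = Σ_S ∏_{i∈S} (pᵢ − gᵢ∘Q) · ∏_{i∉S} (gᵢ∘Q − mᵢ)` (`Finset.prod_add`), integrated termwise;
* the term of `S` is the decoupling integral against the test function
  `Ψ_S := ∏_{i∉S} (gᵢ − mᵢ) / D₁^{n−#S}` (`|Ψ_S| ≤ 1` by the response bound, `D₁ = (C₁+1)/b⁴`), so it is at most
  `D₁^{n−#S} · D₂^{#S}` (`D₂ = C₂/b⁴`, `∫ |Ψ_S∘Q| dμ ≤ 1` on the Wilson probability space);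
* `Σ_S D₂^{#S} D₁^{n−#S} = (D₁ + D₂)ⁿ` (`Finset.sum_pow_mul_eq_add_pow`);
* bookkeeping: `L := 13`, a class torus `M = 2·13ᵉ` (`e ≥ 1`) is the finest lattice of the Bałaban family
  `F = (L := 13, m := e)` at `K := 0` (`T4Family.sitesPerDir_eq`); the averaging depth is `k := ⌊log₁₃ R⌋`, so
  `13ᵏ ≤ R < 13ᵏ⁺¹` gives the window `13ᵏ·uRec β ≤ R·uRec β ≤ ℓ₄`, the depth bound `k + 1 ≤ e` (from
  `8R + 16 ≤ 2·13ᵉ`), the separation `2·13ᵏ + 4 ≤ 2R + 4`, and `(C₁+1+C₂)/(13ᵏ)⁴ ≤ (C₁+1+C₂)·13⁴/R⁴`.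

Elementary measure-theoretic bookkeeping (the route's own "provable now" support item); nothing of E0′ itself,
of `CondResponse`/`CondDecoupling`, of NT or of the gap is proved here; YM mass gap NOT proved.
-/

set_option autoImplicit false

namespace Summit.QuantumFields.YangMills.Cruxes.UVSeamRec.ResponseRegimeSplit

open MeasureTheory
open Literature.MathematicalPhysics.QuantumFieldTheory
open Literature.MathematicalPhysics.QuantumFieldTheory.Balaban1983to89
open Literature.MathematicalPhysics.QuantumFieldTheory.Balaban1983to89.T4Continuum
open Literature.MathematicalPhysics.QuantumLattice (LGConfig torusLift fundamentalLatticeRep)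
open Summit.QuantumFields.YangMills.Cruxes.OSLegsFromFemtoAndGap.DlrCollarTransfer (plane)
open Summit.QuantumFields.YangMills.Cruxes.UV.TorusClass (torusEOn MomentBounds6OnSides)
open Summit.QuantumFields.YangMills.Theses.BalabanFluctuationExport

namespace StubFluctuationExportGlue

/-- **The finite subset expansion (abstract form).**  On a probability space, let `pᵢ` be bounded measurable
observables, `Q` a map to a space of "block fields", `gᵢ` functions of the block field with `gᵢ∘Q` measurable and
`|gᵢ − mᵢ| ≤ D₁` (`D₁ > 0`), and suppose the conditional decoupling bound
`|∫ ∏_{i∈S} (pᵢ − gᵢ∘Q) · Ψ∘Q dμ| ≤ D₂^{#S} ∫ |Ψ∘Q| dμ` holds for every sub-family `S` and every test function `Ψ`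
of the block field with `Ψ∘Q` measurable and `|Ψ| ≤ 1`.  Then `|∫ ∏ᵢ (pᵢ − mᵢ) dμ| ≤ (D₁ + D₂)ⁿ`. -/
theorem abs_integral_prod_sub_le {Ω Wsp : Type*} [MeasurableSpace Ω] (μ : Measure Ω) [IsProbabilityMeasure μ]
    {n : ℕ} (Q : Ω → Wsp) (p : Fin n → Ω → ℝ) (g : Fin n → Wsp → ℝ) (m : Fin n → ℝ) {B D₁ D₂ : ℝ}
    (hD₁ : 0 < D₁) (hD₂ : 0 ≤ D₂)
    (hpm : ∀ i, Measurable (p i)) (hpb : ∀ i ω, |p i ω| ≤ B)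
    (hgm : ∀ i, Measurable fun ω => g i (Q ω)) (hgb : ∀ i W, |g i W - m i| ≤ D₁)
    (hCD : ∀ S : Finset (Fin n), ∀ Ψ : Wsp → ℝ, Measurable (fun ω => Ψ (Q ω)) → (∀ W, |Ψ W| ≤ 1) →
      |∫ ω, (∏ i ∈ S, (p i ω - g i (Q ω))) * Ψ (Q ω) ∂μ| ≤ D₂ ^ S.card * ∫ ω, |Ψ (Q ω)| ∂μ) :
    |∫ ω, ∏ i, (p i ω - m i) ∂μ| ≤ (D₁ + D₂) ^ n := by
  classical
  -- the rescaled complementary products, used as test functions of the block field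
  set Ψ : Finset (Fin n) → Wsp → ℝ := fun S W =>
    (∏ i ∈ Finset.univ \ S, (g i W - m i)) / D₁ ^ (Finset.univ \ S).card with hΨ
  have hΨb : ∀ S W, |Ψ S W| ≤ 1 := by
    intro S W
    simp only [hΨ]
    rw [abs_div, abs_of_pos (pow_pos hD₁ _), div_le_one (pow_pos hD₁ _), Finset.abs_prod,
      ← Finset.prod_const]
    exact Finset.prod_le_prod (fun i _ => abs_nonneg _) fun i _ => hgb i W
  have hΨm : ∀ S, Measurable fun ω => Ψ S (Q ω) := fun S =>
    (Finset.measurable_prod _ fun i _ => (hgm i).sub measurable_const).div_const _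
  -- bounded measurable functions are integrable on the probability space
  have hint : ∀ (f : Ω → ℝ) (A : ℝ), Measurable f → (∀ ω, |f ω| ≤ A) → Integrable f μ :=
    fun f A hfm hfb => Integrable.mono' (integrable_const A) hfm.aestronglyMeasurable
      (Filter.Eventually.of_forall fun ω => by rw [Real.norm_eq_abs]; exact hfb ω)
  have hPm : ∀ S : Finset (Fin n), Measurable fun ω => ∏ i ∈ S, (p i ω - g i (Q ω)) := fun S =>
    Finset.measurable_prod _ fun i _ => (hpm i).sub (hgm i)
  have hPb : ∀ (S : Finset (Fin n)) (ω : Ω),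
      |∏ i ∈ S, (p i ω - g i (Q ω))| ≤ (B + (D₁ + ∑ j, |m j|)) ^ S.card := by
    intro S ω
    rw [Finset.abs_prod, ← Finset.prod_const]
    refine Finset.prod_le_prod (fun i _ => abs_nonneg _) fun i _ => ?_
    have h1 := hgb i (Q ω)
    have h2 : |m i| ≤ ∑ j, |m j| :=
      Finset.single_le_sum (f := fun j => |m j|) (fun j _ => abs_nonneg _) (Finset.mem_univ i)
    have h3 := abs_sub_abs_le_abs_sub (g i (Q ω)) (m i)
    have h4 := abs_sub (p i ω) (g i (Q ω))
    have h5 := hpb i ω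
    linarith
  have hTint : ∀ S : Finset (Fin n),
      Integrable (fun ω => (∏ i ∈ S, (p i ω - g i (Q ω))) * Ψ S (Q ω)) μ :=
    fun S => hint _ ((B + (D₁ + ∑ j, |m j|)) ^ S.card * 1) ((hPm S).mul (hΨm S)) fun ω => by
      rw [abs_mul]
      exact mul_le_mul (hPb S ω) (hΨb S (Q ω)) (abs_nonneg _) ((abs_nonneg _).trans (hPb S ω))
  -- pointwise expansion of the centred product
  have hexp : ∀ ω, ∏ i, (p i ω - m i) =
      ∑ S ∈ (Finset.univ : Finset (Fin n)).powerset,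
        D₁ ^ (Finset.univ \ S).card * ((∏ i ∈ S, (p i ω - g i (Q ω))) * Ψ S (Q ω)) := by
    intro ω
    have h1 : ∏ i, (p i ω - m i) = ∏ i, ((p i ω - g i (Q ω)) + (g i (Q ω) - m i)) :=
      Finset.prod_congr rfl fun i _ => by ring
    rw [h1, Finset.prod_add]
    refine Finset.sum_congr rfl fun S _ => ?_
    have hD : D₁ ^ (Finset.univ \ S).card ≠ 0 := pow_ne_zero _ hD₁.ne'
    simp only [hΨ]
    rw [mul_comm (D₁ ^ (Finset.univ \ S).card), mul_assoc, div_mul_cancel₀ _ hD]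
  -- integrate termwise
  have hI : ∫ ω, ∏ i, (p i ω - m i) ∂μ =
      ∑ S ∈ (Finset.univ : Finset (Fin n)).powerset,
        D₁ ^ (Finset.univ \ S).card * ∫ ω, (∏ i ∈ S, (p i ω - g i (Q ω))) * Ψ S (Q ω) ∂μ := by
    have h1 : ∫ ω, ∏ i, (p i ω - m i) ∂μ = ∫ ω, ∑ S ∈ (Finset.univ : Finset (Fin n)).powerset,
        D₁ ^ (Finset.univ \ S).card * ((∏ i ∈ S, (p i ω - g i (Q ω))) * Ψ S (Q ω)) ∂μ :=
      integral_congr_ae (Filter.Eventually.of_forall hexp)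
    rw [h1, integral_finsetSum _ fun S _ => (hTint S).const_mul _]
    refine Finset.sum_congr rfl fun S _ => ?_
    exact integral_const_mul _ _
  rw [hI]
  calc |∑ S ∈ (Finset.univ : Finset (Fin n)).powerset,
          D₁ ^ (Finset.univ \ S).card * ∫ ω, (∏ i ∈ S, (p i ω - g i (Q ω))) * Ψ S (Q ω) ∂μ|
      ≤ ∑ S ∈ (Finset.univ : Finset (Fin n)).powerset,
          |D₁ ^ (Finset.univ \ S).card * ∫ ω, (∏ i ∈ S, (p i ω - g i (Q ω))) * Ψ S (Q ω) ∂μ| :=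
        Finset.abs_sum_le_sum_abs _ _
    _ ≤ ∑ S ∈ (Finset.univ : Finset (Fin n)).powerset,
          D₂ ^ S.card * D₁ ^ ((Finset.univ : Finset (Fin n)).card - S.card) := by
        refine Finset.sum_le_sum fun S hS => ?_
        rw [abs_mul, abs_of_nonneg (pow_nonneg hD₁.le _),
          Finset.card_sdiff_of_subset (Finset.mem_powerset.mp hS), mul_comm]
        refine mul_le_mul_of_nonneg_right ?_ (pow_nonneg hD₁.le _)
        refine (hCD S (Ψ S) (hΨm S) (hΨb S)).trans ?_
        have hΨi : Integrable (fun ω => |Ψ S (Q ω)|) μ :=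
          (hint _ 1 (hΨm S) fun ω => hΨb S (Q ω)).abs
        have h1 : ∫ ω, |Ψ S (Q ω)| ∂μ ≤ 1 := by
          calc ∫ ω, |Ψ S (Q ω)| ∂μ ≤ ∫ _ω, (1 : ℝ) ∂μ :=
                integral_mono hΨi (integrable_const _) fun ω => hΨb S (Q ω)
            _ = 1 := by simp
        calc D₂ ^ S.card * ∫ ω, |Ψ S (Q ω)| ∂μ ≤ D₂ ^ S.card * 1 :=
              mul_le_mul_of_nonneg_left h1 (pow_nonneg hD₂ _)
          _ = D₂ ^ S.card := mul_one _
    _ = (D₂ + D₁) ^ (Finset.univ : Finset (Fin n)).card := Finset.sum_pow_mul_eq_add_pow _ _ _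
    _ = (D₁ + D₂) ^ n := by rw [Finset.card_univ, Fintype.card_fin, add_comm]

end StubFluctuationExportGlue

open StubFluctuationExportGlue in
/-- **Registered stub `stub_fluctuationExportGlue`** of the line `response_regime_split` = route item
stmt-QuantumFields-26019 `BalabanFluctuationExport.FluctuationExportGlue`:
`CondResponse → CondDecoupling → BalabanFamilyExport.FamilyCeilings`, by the finite subset expansion
(`StubFluctuationExportGlue.abs_integral_prod_sub_le`) at `L := 13`, `K := 0`, `m := e` for the class torus
`M = 2·13ᵉ`, averaging depth `k := ⌊log₁₃ R⌋`. -/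
theorem stub_fluctuationExportGlue : FluctuationExportGlue := by
  intro hCR hCD
  letI : MeasurableSpace (Matrix.specialUnitaryGroup (Fin 2) ℂ) := borel _
  haveI : BorelSpace (Matrix.specialUnitaryGroup (Fin 2) ℂ) := ⟨rfl⟩
  obtain ⟨C₁, β₁, ℓ₁, hℓ₁, hC₁, h₁⟩ := hCR 13 (by decide) (by norm_num)
  obtain ⟨C₂, β₂, ℓ₂, hℓ₂, hC₂, h₂⟩ := hCD 13 (by decide) (by norm_num)
  refine ⟨13, by decide, by norm_num, (C₁ + 1 + C₂) * 13 ^ 4, max β₁ β₂, min ℓ₁ ℓ₂, lt_min hℓ₁ hℓ₂,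
    by positivity, ?_⟩
  intro β hβ M instM hM n q x R hq hR hRu hRM hsep
  obtain ⟨e, he, hMe⟩ := hM
  -- realise the class torus as the finest lattice of the Bałaban family `(L, m) = (13, e)` at `K = 0`
  obtain ⟨F, hFL, hFm⟩ : ∃ F : T4Family, F.L = 13 ∧ F.m = e :=
    ⟨⟨13, ⟨by decide, by norm_num⟩, by norm_num, e, he⟩, rfl, rfl⟩
  have hFM : (F.P 0).sitesPerDir 0 = M := by
    rw [T4Family.sitesPerDir_eq, hFL, hFm, hMe, Nat.add_zero]
  subst hFM
  have hβ₁ : β₁ ≤ β := (le_max_left _ _).trans hβ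
  have hβ₂ : β₂ ≤ β := (le_max_right _ _).trans hβ
  -- the averaging depth `k = ⌊log₁₃ R⌋`
  obtain ⟨k, hk1, hk2⟩ : ∃ k : ℕ, 13 ^ k ≤ R ∧ R < 13 ^ (k + 1) :=
    ⟨Nat.log 13 R, Nat.pow_log_le_self 13 (by omega), Nat.lt_pow_succ_log_self (by norm_num) R⟩
  have hke : k + 1 ≤ F.m + 0 := by
    rw [hFm, Nat.add_zero]
    have h13 : 13 ^ k < 13 ^ e := by
      have h' : 8 * R + 16 ≤ 2 * 13 ^ e := by
        have := hMe; omega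
      omega
    exact Nat.succ_le_of_lt ((Nat.pow_lt_pow_iff_right (by norm_num)).1 h13)
  have huR : 0 < Summit.QuantumFields.YangMills.Cruxes.UVSeamRec.Transport.uRec β :=
    Summit.QuantumFields.YangMills.Cruxes.UVSeamRec.UnitTransfer.uRec_pos β
  have h13R : ((13 : ℕ) : ℝ) ^ k ≤ (R : ℝ) := by exact_mod_cast hk1
  have hb₁ : ((13 : ℕ) : ℝ) ^ k * Summit.QuantumFields.YangMills.Cruxes.UVSeamRec.Transport.uRec β ≤ ℓ₁ :=
    (mul_le_mul_of_nonneg_right h13R huR.le).trans (hRu.trans (min_le_left _ _))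
  have hb₂ : ((13 : ℕ) : ℝ) ^ k * Summit.QuantumFields.YangMills.Cruxes.UVSeamRec.Transport.uRec β ≤ ℓ₂ :=
    (mul_le_mul_of_nonneg_right h13R huR.le).trans (hRu.trans (min_le_right _ _))
  -- the two inputs at this family member and depth
  have h₁' := h₁ β hβ₁ F 0 k hFL hke hb₁
  have h₂' := h₂ β hβ₂ F 0 k hFL hke hb₂
  -- vocabulary
  set Mx : ℕ := (F.P 0).sitesPerDir 0 with hMxdef
  set Q : GaugeConfig 4 Mx (Matrix.specialUnitaryGroup (Fin 2) ℂ) →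
      GaugeField (F.P 0) k (Matrix.specialUnitaryGroup (Fin 2) ℂ) :=
    fun V => Averaging.iter (fun j => BlockAveraging.blockAvg (P := F.P 0) (j := j) su2Mean) k
      (ofConfig (P := F.P 0) (j := 0) V) with hQdef
  set μ : Measure (GaugeConfig 4 Mx (Matrix.specialUnitaryGroup (Fin 2) ℂ)) :=
    wilsonMeasure (d := 4) (L := Mx) (fundamentalLatticeRep 2).ρ β with hμdef
  set pV : Fin n → GaugeConfig 4 Mx (Matrix.specialUnitaryGroup (Fin 2) ℂ) → ℝ :=
    fun i V => plane (Matrix.specialUnitaryGroup (Fin 2) ℂ) (fundamentalLatticeRep 2) (q i) (x i) (torusLift Mx V)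
    with hpVdef
  set mV : Fin n → ℝ := fun i => torusEOn (Matrix.specialUnitaryGroup (Fin 2) ℂ) (fundamentalLatticeRep 2) β Mx
    (plane (Matrix.specialUnitaryGroup (Fin 2) ℂ) (fundamentalLatticeRep 2) (q i) (x i)) with hmVdef
  set b4 : ℝ := (((13 : ℕ) : ℝ) ^ k) ^ 4 with hb4def
  have hb4 : 0 < b4 := by positivity
  -- CondResponse at each insertion: versions gᵢ of E[pᵢ | Q_k]
  have h₁'' : ∀ i : Fin n, ∃ g : GaugeField (F.P 0) k (Matrix.specialUnitaryGroup (Fin 2) ℂ) → ℝ,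
      Measurable (fun V => g (Q V)) ∧ (∀ W, |g W - mV i| ≤ C₁ / b4) ∧
      ∀ φ : GaugeField (F.P 0) k (Matrix.specialUnitaryGroup (Fin 2) ℂ) → ℝ,
        Measurable (fun V => φ (Q V)) → (∀ W, |φ W| ≤ 1) →
        ∫ V, (pV i V - g (Q V)) * φ (Q V) ∂μ = 0 :=
    fun i => h₁' (q i) (x i) (hq i)
  choose g hgm hgb hgo using h₁''
  -- CondDecoupling for every sub-family `S` of the insertions (re-indexed along `Fin #S ≃ S`)
  have hD₀ : ∀ i W, |g i W| ≤ (∑ j, |mV j|) + C₁ / b4 := by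
    intro i W
    have h1 := hgb i W
    have h2 : |mV i| ≤ ∑ j, |mV j| :=
      Finset.single_le_sum (f := fun j => |mV j|) (fun j _ => abs_nonneg _) (Finset.mem_univ i)
    have h3 := abs_sub_abs_le_abs_sub (g i W) (mV i)
    linarith
  have hCDS : ∀ S : Finset (Fin n), ∀ Ψ : GaugeField (F.P 0) k (Matrix.specialUnitaryGroup (Fin 2) ℂ) → ℝ,
      Measurable (fun V => Ψ (Q V)) → (∀ W, |Ψ W| ≤ 1) →
      |∫ V, (∏ i ∈ S, (pV i V - g i (Q V))) * Ψ (Q V) ∂μ| ≤ (C₂ / b4) ^ S.card * ∫ V, |Ψ (Q V)| ∂μ := by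
    intro S Ψ hΨm hΨb
    let ι : Fin S.card → Fin n := fun j => ((S.equivFin.symm j : S) : Fin n)
    have hιinj : Function.Injective ι := fun j j' h =>
      S.equivFin.symm.injective (Subtype.ext h)
    have hsep' : ∀ i j : Fin S.card, i ≠ j → ∃ κ : Fin 4,
        (2 * ((13 : ℕ) : ℤ) ^ k + 4) ≤ |((((x (ι i) κ - x (ι j) κ : ℤ) : ZMod Mx)).valMinAbs : ℤ)| := by
      intro i j hij
      obtain ⟨κ, hκ⟩ := hsep (ι i) (ι j) (fun h => hij (hιinj h))
      refine ⟨κ, le_trans ?_ hκ⟩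
      have : ((13 : ℕ) : ℤ) ^ k ≤ (R : ℤ) := by exact_mod_cast hk1
      linarith
    have key : |∫ V, (∏ j, (pV (ι j) V - g (ι j) (Q V))) * Ψ (Q V) ∂μ| ≤
        (C₂ / b4) ^ S.card * ∫ V, |Ψ (Q V)| ∂μ :=
      h₂' S.card (fun j => q (ι j)) (fun j => x (ι j)) (fun j => hq (ι j)) hsep' (fun j => g (ι j))
        ⟨(∑ j, |mV j|) + C₁ / b4, fun j W => hD₀ (ι j) W⟩ (fun j => hgm (ι j)) (fun j => hgo (ι j))
        Ψ hΨm hΨb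
    have hprod : ∀ V, ∏ j, (pV (ι j) V - g (ι j) (Q V)) = ∏ i ∈ S, (pV i V - g i (Q V)) := by
      intro V
      have e1 : ∏ j, (pV (ι j) V - g (ι j) (Q V)) =
          ∏ s : S, (pV (s : Fin n) V - g (s : Fin n) (Q V)) :=
        Fintype.prod_equiv S.equivFin.symm _ (fun s : S => pV (s : Fin n) V - g (s : Fin n) (Q V))
          fun j => rfl
      rw [e1, Finset.prod_coe_sort S (fun i => pV i V - g i (Q V))]
    calc |∫ V, (∏ i ∈ S, (pV i V - g i (Q V))) * Ψ (Q V) ∂μ|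
        = |∫ V, (∏ j, (pV (ι j) V - g (ι j) (Q V))) * Ψ (Q V) ∂μ| := by simp_rw [hprod]
      _ ≤ (C₂ / b4) ^ S.card * ∫ V, |Ψ (Q V)| ∂μ := key
  -- the probability space and the bounded plane observables
  haveI : IsProbabilityMeasure μ :=
    isProbabilityMeasure_wilsonMeasure (d := 4) (L := Mx) (fundamentalLatticeRep 2).ρ
      (fundamentalLatticeRep 2).continuous β
  obtain ⟨B, hB⟩ := Summit.QuantumFields.YangMills.Cruxes.OSLegsFromFemtoAndGap.DlrCollarTransfer.exists_abs_plane_le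
    (G := Matrix.specialUnitaryGroup (Fin 2) ℂ) (fundamentalLatticeRep 2)
  have hpVm : ∀ i, Measurable (pV i) := fun i =>
    (Summit.QuantumFields.YangMills.Cruxes.OSLegsFromFemtoAndGap.DlrCollarTransfer.continuous_plane
      (G := Matrix.specialUnitaryGroup (Fin 2) ℂ) (fundamentalLatticeRep 2) (q i) (x i)).measurable.comp
      (measurable_torusLift (d := 4) (G := Matrix.specialUnitaryGroup (Fin 2) ℂ) Mx)
  have hpVb : ∀ i V, |pV i V| ≤ B := fun i V => hB (q i) (x i) _
  have hD₁ : 0 < (C₁ + 1) / b4 := by positivity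
  have hD₂ : 0 ≤ C₂ / b4 := by positivity
  have hgb' : ∀ i W, |g i W - mV i| ≤ (C₁ + 1) / b4 := fun i W =>
    (hgb i W).trans (div_le_div_of_nonneg_right (by linarith) hb4.le)
  -- the finite subset expansion
  have key := abs_integral_prod_sub_le μ Q pV g mV hD₁ hD₂ hpVm hpVb hgm hgb' hCDS
  -- constants: (C₁ + 1 + C₂)/(13ᵏ)⁴ ≤ (C₁ + 1 + C₂)·13⁴/R⁴ since R < 13ᵏ⁺¹
  have hRpos : (0 : ℝ) < (R : ℝ) := by exact_mod_cast hR
  have hR13 : (R : ℝ) ≤ 13 * ((13 : ℕ) : ℝ) ^ k := by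
    have : (R : ℝ) ≤ ((13 : ℕ) : ℝ) ^ (k + 1) := by exact_mod_cast hk2.le
    simpa [pow_succ, mul_comm] using this
  have hfin : ((C₁ + 1) / b4 + C₂ / b4) ^ n ≤ ((C₁ + 1 + C₂) * 13 ^ 4 / (R : ℝ) ^ 4) ^ n := by
    refine pow_le_pow_left₀ (by positivity) ?_ n
    have hR4 : (R : ℝ) ^ 4 ≤ 13 ^ 4 * b4 := by
      rw [hb4def, ← mul_pow]
      exact pow_le_pow_left₀ hRpos.le hR13 4
    have h1 : (C₁ + 1) / b4 + C₂ / b4 = (C₁ + 1 + C₂) * 13 ^ 4 / (13 ^ 4 * b4) := by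
      field_simp
    rw [h1]
    exact div_le_div_of_nonneg_left (by positivity) (by positivity) hR4
  -- conclusion: the goal is `|∫ ∏ᵢ (pᵢ − mᵢ) dμ| ≤ (C/R⁴)ⁿ` by the definition of `torusEOn`
  change |∫ V, ∏ i, (pV i V - mV i) ∂μ| ≤ ((C₁ + 1 + C₂) * 13 ^ 4 / (R : ℝ) ^ 4) ^ n
  exact key.trans hfin

end Summit.QuantumFields.YangMills.Cruxes.UVSeamRec.ResponseRegimeSplit
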